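import Literature.Topology.FourManifolds.HomotopySpheresStablyParallelizable
import Literature.AlgebraicTopology.Homotopy.SphereMapsHomotopyGroups
import HarnessLib

/-!
# `π₆(GL(8, ℝ)) = 0` in Mathlib's vocabulary: the named fact `Bott1959_sphereMapsToStableFramesExtend_six`

Topic `Literature/Topology/FourManifolds`, sibling of `HomotopySpheresStablyParallelizable.lean`.
That file vendors the input "`πₙ₋₁(SO) = 0` for `n ≡ 3, 5, 6, 7 (mod 8)`" of Case 1 of
Kervaire–Milnor's proof that homotopy spheres are s-parallelizable (*Groups of homotopy spheres
I*, Ann. of Math. 77 (1963), Thm. 3.1, p. 508), at `n = 7`, as the named fact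
`Literature.Topology.FourManifolds.Bott1959_sphereMapsToStableFramesExtend_six`: every continuous
map from the unit sphere `𝕊⁶ ⊆ ℝ⁷` to the space `StableFrame 7` of stable frames of `ℝ⁷`
(linearly independent `8`-families in `ℝ⁷ × ℝ`, a copy of `GL(8, ℝ)`) extends continuously over
`ℝ⁷` — the *extension form* of `π₆(GL(8, ℝ)) = π₆(SO(8)) = π₆(SO) = 0` (Bott 1959; stability
`πᵢ(SO(k - 1)) ≅ πᵢ(SO(k))` for `i < k - 2`, Kosinski, *Differential Manifolds*, Appendix §5,
(5.1) and p. 230).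

This file PROVES that the extension form is EQUIVALENT to the statement in Mathlib's own
homotopy-group vocabulary,

  `∀ y, Subsingleton (π_ 6 (StableFrame 7) y)`, `π_ n X x = HomotopyGroup (Fin n) X x`,

so that the named fact is exactly "`π₆(GL(8, ℝ), y) = 0` at every base point `y`" (in particular
not stronger), and a computation of `π₆(GL(8, ℝ))` stated for Mathlib's `HomotopyGroup`
discharges it directly:

* `Literature.Topology.FourManifolds.nullhomotopic_of_sphere_extends`,
  `Literature.Topology.FourManifolds.exists_sphere_extends_of_nullhomotopic`: a continuous map of
  the unit sphere of a real normed space `E` extends continuously over `E` iff it is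
  null-homotopic (Hatcher, *Algebraic Topology* (2002), §4.1, p. 346, conditions (1) ⇔ (2) for
  `E = ℝⁿ⁺¹`; the disc `𝔻ⁿ⁺¹` replaced by `ℝⁿ⁺¹`, which changes nothing: restrict, or compose
  with the radial retraction).
* `Literature.Topology.FourManifolds.subsingleton_homotopyGroup_pathComponent`: triviality of
  `π_N(X, z)` passes to the path component of `z` (a null-homotopy rel `∂Iᴺ` has path-connected
  image through `z`).
* `Literature.Topology.FourManifolds.sphereMapsToStableFramesExtend_iff_nullhomotopic`: the
  extension property iff every map `𝕊ⁿ → StableFrame (n + 1)` is null-homotopic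
  ("`[𝕊ⁿ, GL(n + 2, ℝ)] = 0`").
* `Literature.Topology.FourManifolds.subsingleton_homotopyGroup_of_sphereMapsToStableFramesExtend`,
  `Literature.Topology.FourManifolds.sphereMapsToStableFramesExtend_of_subsingleton_homotopyGroup`,
  `Literature.Topology.FourManifolds.sphereMapsToStableFramesExtend_iff_subsingleton_homotopyGroup`:
  `SphereMapsToStableFramesExtend n ↔ ∀ y, π_ n (StableFrame (n + 1)) y = 0` (`n ≥ 1` for `←`:
  the connected sphere lands in one path component, to which Hatcher's criterion (3) ⇒ (1),
  `homotopic_const_of_sphere_of_subsingleton_homotopyGroup` of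
  `Literature/AlgebraicTopology/Homotopy/SphereMapsHomotopyGroups.lean`, applies).
* `Literature.Topology.FourManifolds.Bott1959_sphereMapsToStableFramesExtend_six_iff_subsingleton_homotopyGroup`:
  the case `n = 6`, i.e. the named fact `↔ ∀ y, Subsingleton (π_ 6 (StableFrame 7) y)`.

Everything here is proved; no definitions, no named facts. NOT proved here (and the reason the
named fact stays a named fact): the computation `π₆(SO(8)) = 0` itself — Bott periodicity, or the
unstable ladder `SO(3) ⊂ ⋯ ⊂ SO(8)` through `π₆(S³) = ℤ₁₂`, and the exact homotopy sequences of
the fibrations `SO(k) → SO(k + 1) → Sᵏ` are absent from Mathlib and from the tree.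

## References

* R. Bott, *The stable homotopy of the classical groups*, Ann. of Math. (2) 70 (1959), 313–337
  (Theorem: `πₖ(O)`, `k ≡ 0, …, 7 (mod 8)`, is `ℤ₂, ℤ₂, 0, ℤ, 0, 0, 0, ℤ`). doi:10.2307/1970106
  [Bott1959]
* M. Kervaire, J. Milnor, *Groups of homotopy spheres I*, Ann. of Math. (2) 77 (1963), §3, proof
  of Thm. 3.1, p. 508 (Case 1). [KervaireMilnorAnnals1963]
* A. Kosinski, *Differential Manifolds* (1993), Appendix §5, (5.1) and the stability range
  `πᵢ(SO(k - 1)) ≅ πᵢ(SO(k))`, `i < k - 2` (p. 230). [Kosinski1993]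
* A. Hatcher, *Algebraic Topology*, CUP (2002), §4.1, p. 346 (equivalent conditions (1)–(3) for
  `πᵢ = 0`). [HatcherAT2002]
-/

noncomputable section

namespace Literature.Topology.FourManifolds

open Literature.AlgebraicTopology.Homotopy
open scoped _root_.Topology _root_.Topology.Homotopy unitInterval
open Set Metric

/-! ### Maps of spheres: extension over the ambient space versus null-homotopy -/

section SphereExtension

variable {E : Type*} [NormedAddCommGroup E] [NormedSpace ℝ E] {Y : Type*} [TopologicalSpace Y]

/-- **A map of the unit sphere of a real normed space `E` which extends continuously over `E` is
null-homotopic**: if `F` extends `f`, then `(t, u) ↦ F ((1 - t) u)` is a homotopy from `f` to the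
constant map `F 0` (Hatcher, *Algebraic Topology* (2002), §4.1, p. 346, (2) ⇒ (1), for
`E = ℝⁿ⁺¹`). [cite: HatcherAT2002, §4.1 (p. 346)] -/
theorem nullhomotopic_of_sphere_extends (f : C(sphere (0 : E) 1, Y)) (F : C(E, Y))
    (hF : ∀ u : sphere (0 : E) 1, F u = f u) : f.Nullhomotopic := by
  let H : ContinuousMap.Homotopy f (ContinuousMap.const (sphere (0 : E) 1) (F 0)) :=
    { toFun := fun p => F ((1 - (p.1 : ℝ)) • (p.2 : E)),
      continuous_toFun := by fun_prop,
      map_zero_left := fun u => by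
        show F ((1 - ((0 : I) : ℝ)) • (u : E)) = f u
        rw [Set.Icc.coe_zero, sub_zero, one_smul, hF],
      map_one_left := fun u => by
        show F ((1 - ((1 : I) : ℝ)) • (u : E)) = F 0
        rw [Set.Icc.coe_one, sub_self, zero_smul] }
  exact ⟨F 0, ⟨H⟩⟩

/-- **A null-homotopic map of the unit sphere of a real normed space `E` extends continuously
over `E`** (Hatcher, *Algebraic Topology* (2002), §4.1, p. 346, (1) ⇒ (2), for `E = ℝⁿ⁺¹`, with
the disc replaced by the whole space): given a homotopy `H` from `f` to the constant map `y₀`,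
the map equal to `y₀` on the ball of radius `1/2` and to `H (2 - 2‖x‖, x/‖x‖)` (first argument
clamped to `[0, 1]`) outside it is continuous (the two pieces agree on the sphere of radius
`1/2`, where `H (1, ·) = y₀`) and restricts to `H (0, ·) = f` on the unit sphere.
[cite: HatcherAT2002, §4.1 (p. 346)] -/
theorem exists_sphere_extends_of_nullhomotopic (f : C(sphere (0 : E) 1, Y))
    (hf : f.Nullhomotopic) : ∃ F : C(E, Y), ∀ u : sphere (0 : E) 1, F u = f u := by
  classical
  obtain ⟨y₀, ⟨H⟩⟩ := hf
  -- normalisation lands on the unit sphere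
  have hmem : ∀ x : E, x ≠ 0 → ‖x‖⁻¹ • x ∈ sphere (0 : E) 1 := fun x hx => by
    rw [mem_sphere_zero_iff_norm, norm_smul, norm_inv, norm_norm,
      inv_mul_cancel₀ (norm_ne_zero_iff.2 hx)]
  -- the clamped time parameter `tm x = 2 - 2‖x‖ ∈ [0, 1]`
  let tm : E → I := fun x => Set.projIcc (0 : ℝ) 1 zero_le_one (2 - 2 * ‖x‖)
  have htm : Continuous tm := continuous_projIcc.comp (by fun_prop)
  -- the outer piece, defined off the origin
  let g : E → Y := fun x => if h : x = 0 then y₀ else H (tm x, ⟨‖x‖⁻¹ • x, hmem x h⟩)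
  have hg : ContinuousOn g {x : E | x ≠ 0} := by
    rw [continuousOn_iff_continuous_restrict]
    have h1 : Continuous fun x : {x : E | x ≠ 0} =>
        (⟨‖(x : E)‖⁻¹ • (x : E), hmem x x.2⟩ : sphere (0 : E) 1) :=
      (((continuous_norm.comp continuous_subtype_val).inv₀ fun x =>
        norm_ne_zero_iff.2 x.2).smul continuous_subtype_val).subtype_mk _
    have hrw : {x : E | x ≠ 0}.restrict g = fun x : {x : E | x ≠ 0} =>
        H (tm x, ⟨‖(x : E)‖⁻¹ • (x : E), hmem x x.2⟩) := by
      funext x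
      exact dif_neg x.2
    rw [hrw]
    exact H.continuous.comp ((htm.comp continuous_subtype_val).prodMk h1)
  -- the extension: `y₀` on the ball of radius `1/2`, `g` outside
  let F : E → Y := fun x => if ‖x‖ ≤ 2⁻¹ then y₀ else g x
  have hF : Continuous F := by
    refine continuous_if_le continuous_norm continuous_const continuousOn_const
      (hg.mono fun x hx h0 => ?_) fun x hx => ?_
    · have hx' : (2⁻¹ : ℝ) ≤ ‖x‖ := hx
      rw [h0, norm_zero] at hx'
      norm_num at hx'
    · have hx0 : x ≠ 0 := fun h => by
        rw [h, norm_zero] at hx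
        norm_num at hx
      have htm1 : tm x = 1 := Subtype.ext (by
        rw [Set.coe_projIcc, hx, Set.Icc.coe_one]
        norm_num)
      show y₀ = g x
      simp only [g, dif_neg hx0, htm1, ContinuousMap.Homotopy.apply_one,
        ContinuousMap.const_apply]
  refine ⟨⟨F, hF⟩, fun u => ?_⟩
  have hu1 : ‖(u : E)‖ = 1 := norm_eq_of_mem_sphere u
  have hu0 : (u : E) ≠ 0 := ne_zero_of_mem_unit_sphere u
  have htm0 : tm u = 0 := Subtype.ext (by
    rw [Set.coe_projIcc, hu1, Set.Icc.coe_zero]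
    norm_num)
  have hnle : ¬ ‖(u : E)‖ ≤ 2⁻¹ := by
    rw [hu1]
    norm_num
  have hu : (⟨‖(u : E)‖⁻¹ • (u : E), hmem u hu0⟩ : sphere (0 : E) 1) = u :=
    Subtype.ext (by
      change ‖(u : E)‖⁻¹ • (u : E) = u
      rw [hu1, inv_one, one_smul])
  show F u = f u
  simp only [F, if_neg hnle, g, dif_neg hu0, htm0, ContinuousMap.Homotopy.apply_zero, hu]

end SphereExtension

/-! ### Triviality of `π_N` passes to path components -/

section PathComponent

variable {N : Type*} {X : Type*} [TopologicalSpace X]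

/-- **If `π_N(X, z) = 0` then `π_N(P, z) = 0` for the path component `P ∋ z` of `X`**: a
null-homotopy rel `∂Iᴺ` in `X` of an `N`-loop of `P` based at `z` has path-connected image
(`I × Iᴺ` is path connected) containing `z`, so it is a null-homotopy in `P`. [folklore] -/
theorem subsingleton_homotopyGroup_pathComponent (x₀ : X) (z : ↥(pathComponent x₀))
    (h : Subsingleton (HomotopyGroup N X (z : X))) :
    Subsingleton (HomotopyGroup N (↥(pathComponent x₀)) z) := by
  rw [subsingleton_homotopyGroup_iff] at h ⊢
  intro p
  -- the loop read in `X`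
  let p' : Ω^ N X (z : X) :=
    ⟨(⟨Subtype.val, continuous_subtype_val⟩ : C(↥(pathComponent x₀), X)).comp p.1,
      fun y hy => congrArg Subtype.val (p.2 y hy)⟩
  obtain ⟨H⟩ := h p'
  -- its null-homotopy stays in the path component
  haveI : PathConnectedSpace I := isPathConnected_iff_pathConnectedSpace.mp
    ((convex_Icc (0 : ℝ) 1).isPathConnected ⟨0, le_rfl, zero_le_one⟩)
  have hrange : ∀ q : I × (N → I), H q ∈ pathComponent x₀ := by
    intro q
    have h1 : range H ⊆ pathComponent (H (1, q.2)) :=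
      (isPathConnected_range H.continuous).subset_pathComponent (mem_range_self _)
    have h2 : H (1, q.2) = (z : X) := H.apply_one q.2
    have h3 : pathComponent (H (1, q.2)) = pathComponent x₀ := by
      rw [h2]
      exact pathComponent_congr z.2
    have h4 := h1 (mem_range_self q)
    rwa [h3] at h4
  let H' : (p.1).HomotopyRel (GenLoop.const : Ω^ N (↥(pathComponent x₀)) z).1
      (Cube.boundary N) :=
    { toFun := fun q => ⟨H q, hrange q⟩,
      continuous_toFun := H.continuous.subtype_mk _,
      map_zero_left := fun y => Subtype.ext (H.apply_zero y),
      map_one_left := fun y => Subtype.ext (H.apply_one y),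
      prop' := fun t y hy => Subtype.ext (H.eq_fst t hy) }
  exact ⟨H'⟩

end PathComponent

/-! ### The extension property for stable frames versus `π_ n (StableFrame (n + 1)) = 0` -/

/-- **`SphereMapsToStableFramesExtend n` iff every continuous map `𝕊ⁿ → StableFrame (n + 1)` is
null-homotopic** — the free-homotopy reading "`[𝕊ⁿ, GL(n + 2, ℝ)] = 0`" of the extension
property (Hatcher 2002, §4.1, p. 346, (1) ⇔ (2)). [cite: HatcherAT2002, §4.1 (p. 346)] -/
theorem sphereMapsToStableFramesExtend_iff_nullhomotopic {n : ℕ} :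
    SphereMapsToStableFramesExtend n ↔
      ∀ f : C(sphere (0 : EuclideanSpace ℝ (Fin (n + 1))) 1, StableFrame (n + 1)),
        f.Nullhomotopic :=
  ⟨fun h f => by
      obtain ⟨F, hF⟩ := h f
      exact nullhomotopic_of_sphere_extends f F hF,
    fun h f => exists_sphere_extends_of_nullhomotopic f (h f)⟩

/-- **`SphereMapsToStableFramesExtend n` implies `π_ n (StableFrame (n + 1)) = 0` at every base
point**: every map `𝕊ⁿ → StableFrame (n + 1)` extends over `ℝⁿ⁺¹`, hence is null-homotopic
(`nullhomotopic_of_sphere_extends`), and then Mathlib's `π_ n` vanishes at every base point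
(`subsingleton_homotopyGroup_of_sphereMaps_nullhomotopic`: cube classes factor through
`Iⁿ/∂Iⁿ ≅ 𝕊ⁿ`, free null-homotopies give based ones; Hatcher 2002, §4.1, p. 346, (2) ⇒ (3)).
[cite: HatcherAT2002, §4.1 (p. 346)] -/
theorem subsingleton_homotopyGroup_of_sphereMapsToStableFramesExtend {n : ℕ}
    (h : SphereMapsToStableFramesExtend n) (y : StableFrame (n + 1)) :
    Subsingleton (π_ n (StableFrame (n + 1)) y) :=
  subsingleton_homotopyGroup_of_sphereMaps_nullhomotopic (N := n)
    (fun g => by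
      obtain ⟨F, hF⟩ := h g
      exact nullhomotopic_of_sphere_extends g F hF) y

/-- **`π_ n (StableFrame (n + 1)) = 0` at every base point implies
`SphereMapsToStableFramesExtend n`** (`n ≥ 1`): a map `f : 𝕊ⁿ → StableFrame (n + 1)` of the
path-connected sphere lands in the path component `P` of `f e₀`; `P` is path connected with
`π_ n (P) = 0` at every base point (`subsingleton_homotopyGroup_pathComponent`), so `f` is
null-homotopic in `P` (Hatcher 2002, §4.1, p. 346, (3) ⇒ (1):
`homotopic_const_of_sphere_of_subsingleton_homotopyGroup`), hence in `StableFrame (n + 1)`, hence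
extends over `ℝⁿ⁺¹` (`exists_sphere_extends_of_nullhomotopic`).
[cite: HatcherAT2002, §4.1 (p. 346)] -/
theorem sphereMapsToStableFramesExtend_of_subsingleton_homotopyGroup {n : ℕ} (hn : 1 ≤ n)
    (h : ∀ y : StableFrame (n + 1), Subsingleton (π_ n (StableFrame (n + 1)) y)) :
    SphereMapsToStableFramesExtend n := by
  intro f
  -- a base point of the sphere and the path component of its image
  let u₀ : sphere (0 : EuclideanSpace ℝ (Fin (n + 1))) 1 :=
    ⟨EuclideanSpace.single 0 1, by simp⟩
  haveI : PathConnectedSpace ↥(pathComponent (f u₀)) :=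
    isPathConnected_iff_pathConnectedSpace.mp isPathConnected_pathComponent
  -- the sphere is path connected (`n ≥ 1`), so `f` lands in that component
  have hrk : 1 < Module.rank ℝ (EuclideanSpace ℝ (Fin (n + 1))) := by
    rw [← Module.finrank_eq_rank, finrank_euclideanSpace_fin]
    exact_mod_cast Nat.lt_succ_of_le hn
  haveI : PathConnectedSpace (sphere (0 : EuclideanSpace ℝ (Fin (n + 1))) 1) :=
    isPathConnected_iff_pathConnectedSpace.mp (isPathConnected_sphere hrk 0 zero_le_one)
  have hfP : ∀ u : sphere (0 : EuclideanSpace ℝ (Fin (n + 1))) 1, f u ∈ pathComponent (f u₀) :=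
    fun u => ⟨(PathConnectedSpace.somePath u₀ u).map f.continuous⟩
  let fP : C(sphere (0 : EuclideanSpace ℝ (Fin (n + 1))) 1, ↥(pathComponent (f u₀))) :=
    ⟨fun u => ⟨f u, hfP u⟩, f.continuous.subtype_mk _⟩
  -- `π_ n` of the component vanishes, so `fP` is null-homotopic
  have hπ : 1 ≤ n → ∀ z : ↥(pathComponent (f u₀)),
      Subsingleton (π_ n (↥(pathComponent (f u₀))) z) :=
    fun _ z => subsingleton_homotopyGroup_pathComponent (f u₀) z (h z)
  have hnull : fP.Nullhomotopic :=
    ⟨fP u₀, homotopic_const_of_sphere_of_subsingleton_homotopyGroup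
      (E := EuclideanSpace ℝ (Fin (n + 1))) (m := n) finrank_euclideanSpace_fin hπ fP (fP u₀)⟩
  have hcomp : (⟨Subtype.val, continuous_subtype_val⟩ :
      C(↥(pathComponent (f u₀)), StableFrame (n + 1))).comp fP = f :=
    ContinuousMap.ext fun _ => rfl
  have hnull' : f.Nullhomotopic := hcomp ▸ hnull.comp_right _
  exact exists_sphere_extends_of_nullhomotopic f hnull'

/-- **The extension property is exactly `π_ n (StableFrame (n + 1)) = 0`** (`n ≥ 1`, all base
points; Hatcher 2002, §4.1, p. 346, (1) ⇔ (2) ⇔ (3)). [cite: HatcherAT2002, §4.1 (p. 346)] -/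
theorem sphereMapsToStableFramesExtend_iff_subsingleton_homotopyGroup {n : ℕ} (hn : 1 ≤ n) :
    SphereMapsToStableFramesExtend n ↔
      ∀ y : StableFrame (n + 1), Subsingleton (π_ n (StableFrame (n + 1)) y) :=
  ⟨subsingleton_homotopyGroup_of_sphereMapsToStableFramesExtend,
    sphereMapsToStableFramesExtend_of_subsingleton_homotopyGroup hn⟩

/-! ### The named fact `Bott1959_sphereMapsToStableFramesExtend_six` is `π₆(GL(8, ℝ)) = 0` -/

/-- **`π₆(GL(8, ℝ)) = 0` in Mathlib's vocabulary implies the named fact.** If Mathlib's homotopy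
group `π_ 6 (StableFrame 7) y = HomotopyGroup (Fin 6) (StableFrame 7) y` of the space of stable
frames of `ℝ⁷` (a copy of `GL(8, ℝ)`) is trivial at every base point `y`, then
`Bott1959_sphereMapsToStableFramesExtend_six` holds. This is the direction a computation of
`π₆(GL(8, ℝ)) = π₆(SO(8)) = π₆(SO) = 0` (Bott 1959; Kosinski, Appendix (5.1) and p. 230) stated
for Mathlib's `HomotopyGroup` would feed.
[cite: Bott1959, Theorem (π₆(O) = 0)] [cite: Kosinski1993, Appendix (5.1) and p. 230]
[cite: HatcherAT2002, §4.1 (p. 346)] -/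
theorem Bott1959_sphereMapsToStableFramesExtend_six_of_subsingleton_homotopyGroup
    (h : ∀ y : StableFrame 7, Subsingleton (π_ 6 (StableFrame 7) y)) :
    Bott1959_sphereMapsToStableFramesExtend_six :=
  sphereMapsToStableFramesExtend_of_subsingleton_homotopyGroup (n := 6) (by norm_num) h

/-- **The named fact implies `π₆(GL(8, ℝ)) = 0` in Mathlib's vocabulary**: under
`Bott1959_sphereMapsToStableFramesExtend_six`, `π_ 6 (StableFrame 7) y` is trivial at every base
point `y`. [cite: Bott1959, Theorem (π₆(O) = 0)] [cite: HatcherAT2002, §4.1 (p. 346)] -/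
theorem subsingleton_homotopyGroup_of_Bott1959_sphereMapsToStableFramesExtend_six
    (h : Bott1959_sphereMapsToStableFramesExtend_six) (y : StableFrame 7) :
    Subsingleton (π_ 6 (StableFrame 7) y) :=
  subsingleton_homotopyGroup_of_sphereMapsToStableFramesExtend h y

/-- **The named fact `Bott1959_sphereMapsToStableFramesExtend_six` is exactly
`π₆(GL(8, ℝ)) = 0`** for Mathlib's homotopy groups of the space `StableFrame 7` of stable frames
of `ℝ⁷`, at all base points (Bott 1959: `π₆(O) = 0`; stability `π₆(SO(8)) ≅ π₆(SO)`, Kosinski,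
Appendix p. 230; the dictionary of Hatcher 2002, §4.1, p. 346).
[cite: Bott1959, Theorem (π₆(O) = 0)] [cite: Kosinski1993, Appendix (5.1) and p. 230]
[cite: HatcherAT2002, §4.1 (p. 346)] -/
theorem Bott1959_sphereMapsToStableFramesExtend_six_iff_subsingleton_homotopyGroup :
    Bott1959_sphereMapsToStableFramesExtend_six ↔
      ∀ y : StableFrame 7, Subsingleton (π_ 6 (StableFrame 7) y) :=
  sphereMapsToStableFramesExtend_iff_subsingleton_homotopyGroup (n := 6) (by norm_num)

end Literature.Topology.FourManifolds

end
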